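import Summits.QuantumFields.BalabanUV.Beta.D1BFx.ReducedKernelF

/-!
# `BalabanUV.Beta.D1BFx.ReducedTableF` — road «BF-x» for binder row D1, typer object T8-tab: THE `ℋ ⊗ ℋ` DRESSING OF FINE-BOND
# SECOND-ORDER TABLES into the coarse `W`-slot of `ReducedKernelF.TOfLeg` / `ReducedKernel.TOfRed` (any fibre `F`), with its
# localisation (`VertexFamily₂`) and block-covariance sockets

HONEST DEPENDENCY (page 1, mandatory): continuum YM on T⁴ ⇐ BetaPertH ∧ nine spine estimates (0/9 proved); BetaPertH ⇐ (D1) ∧ (D4) ∧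
CAP+tail; G-an2-4 gates asym, D1 and NE2/3/4.  HONEST FRAMING: discharging `BetaPertH` makes Bałaban's UV stability UNCONDITIONAL — NOT
the continuum limit and NOT the Clay problem.  THIS FILE DISCHARGES NOTHING: one definition with a body and [folklore] bookkeeping
(weighted sums of bi-localised kernels); 0 binders of the hR root are touched.
ABSOLUTE RULE (cell charter, verbatim): «No internally-minted statement may enter as a cited fact. Every hypothesis is either
kernel-proved in this package or a verbatim quotation of a PUBLISHED theorem with page reference. The manuscript(s) under audit are NOT
citable for their own disputed steps — they are the thing under adjudication; programme-internal (2001/route/tribunal) claims are never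
citable.»  Accordingly there is NO `def … : Prop` below and no hypothesis of any theorem is a printed statement.

WHY (TYPER-SPEC `HOME/b2b-balaban-beta-d1-p2/TYPER-SPEC-D1BFx.md` §1 T8 «`hessKer (Ga n a) (… dressing of Sbf by ℋ_n) (ℋ_n-dressed Wbf)`»;
typer XREAD of `ReducedKernelF` p209591, item (I-2)).  `ReducedKernelF.TOfLeg n A S W` dresses the FIRST-order fine stencils `S κ′ u` by the
minimiser response `wH` (`vertexRedF`), but takes its SECOND-order tables ALREADY COARSE: `W : Fin 4 → Site 4 → Fin 4 → Site 4 → MKer 4 F`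
with `VertexFamily₂ W n Cw δ` (bi-localised at `(n•y, n•y′)`).  The second-order tables the typer spec produces (T5 `Wbf`, T6 `Wgh`) are
indexed by two FINE bonds `(κ′,u), (λ′,u′)` and bi-localised at `(u, u′)`.  This file is the missing W-side twin of `vertexRedF`:
* §1 [folklore] ONE-LEG-PINNED weighted sums: `biLoc_wsum_row` (kernels `K u` bi-localised at `(u, q)`, weights decaying from `p` ⇒
  `wsum w K` bi-localised at `(p, q)`) and `biLoc_wsum_col` (kernels at `(q, u)` ⇒ `(q, p)`), rate `δ/2`, constant `C·C_K·Zl(δ/2)` — the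
  proofs of `OneStepResolventKernel.biLoc_wsum` with one triangle inequality instead of two; `wsum_shiftK`, `wsum_sub` (re-indexing).
* §2 [our object] `tableRedF n Wf μ y ν y′ := Σ_{κ′} Σ_{λ′} Σ′_u wH κ′ μ (u − n•y) · Σ′_{u′} wH λ′ ν (u′ − n•y′) · Wf κ′ u λ′ u′` — VERBATIM the
  two-sided version of the body of `ReducedKernelF.vertexRedF` / `OneStepResolventKernel.vertexOf` (same `KernelSpecInstance.wH`, same
  `wsum`).  A DEFINITION; asserts nothing (in particular NOT that Bałaban's second-order BF/ghost tables are of this form — that is the road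
  owner's node-O bookkeeping, CHECK-N0).
* §3 [folklore] sockets: `vertexFamily₂_tableRedF` (explicit constant, from `∀ κ′ u λ′ u′, BiLoc (Wf κ′ u λ′ u′) u u′ Cf δ` and the tree decay
  of `wH`), the packaged `∃`-form `vertexFamily₂_tableRedF'` (via `KernelSpecInstance.decay_wH`), and BLOCK covariance `tableRedF_translate`
  from block covariance of the fine tables (`Wf κ′ (u + n•t) λ′ (u′ + n•t) = shiftK (−n•t) (Wf κ′ u λ′ u′)`, the shape T6's `GhostStencil`
  tables and an1's `vhS`-type objects have) — exactly the `hW` hypothesis of `ReducedKernelF.blockCovariant_TOfLeg`.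
NOT HERE: which fine tables are Bałaban's (T5/T6/CHECK-N0), colour weights, any estimate uniform in `n`.  Unit `b2b-balaban-beta-d1-formalise-typer`
(planner seat; filed byte-identical by a prover-role courier).
-/

noncomputable section

namespace Summit.QuantumFields.BalabanUV.Beta.D1BFx.ReducedTableF

open Finset
open Literature.MathematicalPhysics.QuantumFieldTheory.Balaban1983to89
open Literature.MathematicalPhysics.QuantumFieldTheory.Balaban1983to89.Beta
open B12Sec2to5 (l1 l1_nonneg Decay510)
open ExpKernelCalculus (Site MKer BiLoc VertexFamily₂ shiftK Zl summable_exp_shift tsum_exp_shift l1_sub_triangle)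
open KernelSpecInstance (wH decay_wH)
open OneStepResolventKernel (wsum bound_mono biLoc_mono biLoc_finset_sum)

variable {F : Type*}

/-! ## §1 One-leg-pinned weighted sums (folklore) -/

section Pinned

variable {D : ℕ} {w : Site D → ℝ} {K : Site D → MKer D F} {C Ck δ : ℝ} {p q : Site D}

/-- [folklore] Termwise bound, ROW leg at the index: weights decaying from `p`, `K u` bi-localised at `(u, q)` ⇒
`|w u · K u x z| ≤ C·C_K·e^{−(δ/2)(|x−p|₁+|z−q|₁)}·e^{−(δ/2)|x−u|₁}`. -/
theorem abs_wsumTerm_le_row (hw : ∀ u, |w u| ≤ C * Real.exp (-δ * l1 (u - p))) (hK : ∀ u, BiLoc (K u) u q Ck δ) (hδ : 0 ≤ δ)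
    (hC : 0 ≤ C) (x z : Site D) (a b : F) (u : Site D) :
    |w u * K u x z a b| ≤ C * Ck * Real.exp (-(δ / 2) * (l1 (x - p) + l1 (z - q))) * Real.exp (-(δ / 2) * l1 (x - u)) := by
  rw [abs_mul]
  have h1 := hw u
  have h2 := hK u x z a b
  have hCk : 0 ≤ Ck := (hK u).nonneg a
  calc |w u| * |K u x z a b|
      ≤ (C * Real.exp (-δ * l1 (u - p))) * (Ck * Real.exp (-δ * (l1 (x - u) + l1 (z - q)))) :=
        mul_le_mul h1 h2 (abs_nonneg _) ((abs_nonneg _).trans h1)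
    _ = C * Ck * Real.exp (-δ * l1 (u - p) + -δ * (l1 (x - u) + l1 (z - q))) := by rw [Real.exp_add]; ring
    _ ≤ C * Ck * Real.exp (-(δ / 2) * (l1 (x - p) + l1 (z - q)) + -(δ / 2) * l1 (x - u)) := by
        refine mul_le_mul_of_nonneg_left (Real.exp_le_exp.2 ?_) (mul_nonneg hC hCk)
        have tx : l1 (x - p) ≤ l1 (x - u) + l1 (u - p) := l1_sub_triangle x u p
        nlinarith [mul_nonneg hδ (show 0 ≤ l1 (x - u) + l1 (u - p) - l1 (x - p) by linarith),
          mul_nonneg hδ (l1_nonneg (z - q)), mul_nonneg hδ (l1_nonneg (x - u)), mul_nonneg hδ (l1_nonneg (u - p))]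
    _ = _ := by rw [Real.exp_add]; ring

/-- [folklore] Termwise bound, COLUMN leg at the index: weights decaying from `p`, `K u` bi-localised at `(q, u)` ⇒
`|w u · K u x z| ≤ C·C_K·e^{−(δ/2)(|x−q|₁+|z−p|₁)}·e^{−(δ/2)|z−u|₁}`. -/
theorem abs_wsumTerm_le_col (hw : ∀ u, |w u| ≤ C * Real.exp (-δ * l1 (u - p))) (hK : ∀ u, BiLoc (K u) q u Ck δ) (hδ : 0 ≤ δ)
    (hC : 0 ≤ C) (x z : Site D) (a b : F) (u : Site D) :
    |w u * K u x z a b| ≤ C * Ck * Real.exp (-(δ / 2) * (l1 (x - q) + l1 (z - p))) * Real.exp (-(δ / 2) * l1 (z - u)) := by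
  rw [abs_mul]
  have h1 := hw u
  have h2 := hK u x z a b
  have hCk : 0 ≤ Ck := (hK u).nonneg a
  calc |w u| * |K u x z a b|
      ≤ (C * Real.exp (-δ * l1 (u - p))) * (Ck * Real.exp (-δ * (l1 (x - q) + l1 (z - u)))) :=
        mul_le_mul h1 h2 (abs_nonneg _) ((abs_nonneg _).trans h1)
    _ = C * Ck * Real.exp (-δ * l1 (u - p) + -δ * (l1 (x - q) + l1 (z - u))) := by rw [Real.exp_add]; ring
    _ ≤ C * Ck * Real.exp (-(δ / 2) * (l1 (x - q) + l1 (z - p)) + -(δ / 2) * l1 (z - u)) := by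
        refine mul_le_mul_of_nonneg_left (Real.exp_le_exp.2 ?_) (mul_nonneg hC hCk)
        have tz : l1 (z - p) ≤ l1 (z - u) + l1 (u - p) := l1_sub_triangle z u p
        nlinarith [mul_nonneg hδ (show 0 ≤ l1 (z - u) + l1 (u - p) - l1 (z - p) by linarith),
          mul_nonneg hδ (l1_nonneg (x - q)), mul_nonneg hδ (l1_nonneg (z - u)), mul_nonneg hδ (l1_nonneg (u - p))]
    _ = _ := by rw [Real.exp_add]; ring

/-- [folklore] **ROW-PINNED SUPERPOSITION**: `BiLoc (wsum w K) p q (C·C_K·Zl(δ/2)) (δ/2)` when `K u` is bi-localised at `(u, q)`. -/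
theorem biLoc_wsum_row (hw : ∀ u, |w u| ≤ C * Real.exp (-δ * l1 (u - p))) (hK : ∀ u, BiLoc (K u) u q Ck δ) (hδ : 0 < δ)
    (hC : 0 ≤ C) : BiLoc (wsum w K) p q (C * Ck * Zl D (δ / 2)) (δ / 2) := by
  intro x z a b
  unfold wsum
  have hmaj := (summable_exp_shift (half_pos hδ) x).mul_left (C * Ck * Real.exp (-(δ / 2) * (l1 (x - p) + l1 (z - q))))
  have hb := tsum_of_norm_bounded hmaj.hasSum
    (fun u => by rw [Real.norm_eq_abs]; exact abs_wsumTerm_le_row hw hK hδ.le hC x z a b u)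
  rw [Real.norm_eq_abs] at hb
  refine hb.trans (le_of_eq ?_)
  rw [tsum_mul_left, tsum_exp_shift]
  ring

/-- [folklore] **COLUMN-PINNED SUPERPOSITION**: `BiLoc (wsum w K) q p (C·C_K·Zl(δ/2)) (δ/2)` when `K u` is bi-localised at `(q, u)`. -/
theorem biLoc_wsum_col (hw : ∀ u, |w u| ≤ C * Real.exp (-δ * l1 (u - p))) (hK : ∀ u, BiLoc (K u) q u Ck δ) (hδ : 0 < δ)
    (hC : 0 ≤ C) : BiLoc (wsum w K) q p (C * Ck * Zl D (δ / 2)) (δ / 2) := by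
  intro x z a b
  unfold wsum
  have hmaj := (summable_exp_shift (half_pos hδ) z).mul_left (C * Ck * Real.exp (-(δ / 2) * (l1 (x - q) + l1 (z - p))))
  have hb := tsum_of_norm_bounded hmaj.hasSum
    (fun u => by rw [Real.norm_eq_abs]; exact abs_wsumTerm_le_col hw hK hδ.le hC x z a b u)
  rw [Real.norm_eq_abs] at hb
  refine hb.trans (le_of_eq ?_)
  rw [tsum_mul_left, tsum_exp_shift]
  ring

/-- [folklore] A simultaneous shift of every kernel of the family passes through the superposition (definitional). -/
theorem wsum_shiftK (w : Site D → ℝ) (K : Site D → MKer D F) (v : Site D) :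
    wsum w (fun u => shiftK v (K u)) = shiftK v (wsum w K) := by
  funext x z a b
  simp only [wsum, shiftK]

/-- [folklore] Re-indexing the superposition by a translation of the fine index. -/
theorem wsum_sub (w : Site D → ℝ) (K : Site D → MKer D F) (v : Site D) :
    wsum (fun u => w (u - v)) (fun u => K (u - v)) = wsum w K := by
  funext x z a b
  simp only [wsum]
  exact (Equiv.subRight v).tsum_eq (fun u => w u * K u x z a b)

end Pinned

/-! ## §2 The dressing of fine-bond second-order tables -/

/-- [our object] **THE `ℋ ⊗ ℋ`-DRESSED SECOND-ORDER TABLE ON ANY FIBRE** (blocking `n`): for a family `Wf κ′ u λ′ u′ : MKer 4 F` indexed by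
two FINE bonds, `tableRedF n Wf μ y ν y′ := Σ_{κ′} Σ_{λ′} Σ′_u wH κ′ μ (u − n•y) · Σ′_{u′} wH λ′ ν (u′ − n•y′) · Wf κ′ u λ′ u′` — the coarse-bond
pair `((μ,y),(ν,y′))` receives every fine pair weighted by the minimiser responses, VERBATIM the two-sided version of `ReducedKernelF.vertexRedF`.
A DEFINITION; asserts nothing. -/
def tableRedF (n : ℕ) [NeZero n] (Wf : Fin 4 → Site 4 → Fin 4 → Site 4 → MKer 4 F) (μ : Fin 4) (y : Site 4) (ν : Fin 4)
    (y' : Site 4) : MKer 4 F :=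
  fun x z a b => ∑ κ' : Fin 4, ∑ l' : Fin 4,
    wsum (fun u => wH (N := n) (d := 3) κ' μ (u - (n : ℤ) • y))
      (fun u => wsum (fun u' => wH (N := n) (d := 3) l' ν (u' - (n : ℤ) • y')) (Wf κ' u l')) x z a b

variable (n : ℕ) [NeZero n]

/-- [our object] Unfolding `tableRedF`. -/
theorem tableRedF_apply (Wf : Fin 4 → Site 4 → Fin 4 → Site 4 → MKer 4 F) (μ : Fin 4) (y : Site 4) (ν : Fin 4) (y' : Site 4)
    (x z : Site 4) (a b : F) :
    tableRedF n Wf μ y ν y' x z a b = ∑ κ' : Fin 4, ∑ l' : Fin 4,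
      wsum (fun u => wH (N := n) (d := 3) κ' μ (u - (n : ℤ) • y))
        (fun u => wsum (fun u' => wH (N := n) (d := 3) l' ν (u' - (n : ℤ) • y')) (Wf κ' u l')) x z a b := rfl

/-! ## §3 Sockets: localisation and block covariance -/

variable {Wf : Fin 4 → Site 4 → Fin 4 → Site 4 → MKer 4 F}

/-- [folklore] **THE DRESSED TABLE IS A SECOND-ORDER VERTEX FAMILY** (explicit constant): fine tables bi-localised at `(u, u′)` with
constant `Cf` and rate `δ`, weights `|wH κ l v| ≤ Cw·e^{−δw|v|₁}` (`Decay510`) with `δ ≤ δw` ⇒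
`VertexFamily₂ (tableRedF n Wf) n (4·(4·(Cw·(Cw·Cf·Zl(δ/2))·Zl(δ/4)))) (δ/4)` (inner sum: `biLoc_wsum_col`; outer: `biLoc_wsum_row`). -/
theorem vertexFamily₂_tableRedF {Cf δ : ℝ} (hWf : ∀ κ' u l' u', BiLoc (Wf κ' u l' u') u u' Cf δ) (hδ : 0 < δ) {Cw δw : ℝ}
    (hCw : 0 ≤ Cw) (hδw : δ ≤ δw) (hwH : ∀ κ l : Fin 4, Decay510 (wH (N := n) (d := 3) κ l) Cw δw) :
    VertexFamily₂ (tableRedF n Wf) n ((4 : ℕ) * ((4 : ℕ) * (Cw * (Cw * Cf * Zl 4 (δ / 2)) * Zl 4 (δ / 2 / 2)))) (δ / 2 / 2) := by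
  intro μ y ν y'
  have hδ2 : 0 < δ / 2 := half_pos hδ
  have hw1 : ∀ (l' : Fin 4) (u' : Site 4),
      |wH (N := n) (d := 3) l' ν (u' - (n : ℤ) • y')| ≤ Cw * Real.exp (-δ * l1 (u' - (n : ℤ) • y')) :=
    fun l' u' => bound_mono (hwH l' ν (u' - (n : ℤ) • y')) hCw le_rfl hδw (l1_nonneg _)
  have hw2 : ∀ (κ' : Fin 4) (u : Site 4),
      |wH (N := n) (d := 3) κ' μ (u - (n : ℤ) • y)| ≤ Cw * Real.exp (-(δ / 2) * l1 (u - (n : ℤ) • y)) :=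
    fun κ' u => bound_mono (hwH κ' μ (u - (n : ℤ) • y)) hCw le_rfl (by linarith) (l1_nonneg _)
  have hinner : ∀ (κ' l' : Fin 4) (u : Site 4), BiLoc (wsum (fun u' => wH (N := n) (d := 3) l' ν (u' - (n : ℤ) • y')) (Wf κ' u l'))
      u ((n : ℤ) • y') (Cw * Cf * Zl 4 (δ / 2)) (δ / 2) :=
    fun κ' l' u => biLoc_wsum_col (hw1 l') (fun u' => hWf κ' u l' u') hδ hCw
  have hterm : ∀ κ' l' : Fin 4, BiLoc (wsum (fun u => wH (N := n) (d := 3) κ' μ (u - (n : ℤ) • y))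
      (fun u => wsum (fun u' => wH (N := n) (d := 3) l' ν (u' - (n : ℤ) • y')) (Wf κ' u l')))
      ((n : ℤ) • y) ((n : ℤ) • y') (Cw * (Cw * Cf * Zl 4 (δ / 2)) * Zl 4 (δ / 2 / 2)) (δ / 2 / 2) :=
    fun κ' l' => biLoc_wsum_row (hw2 κ') (fun u => hinner κ' l' u) hδ2 hCw
  have hsum : ∀ κ' : Fin 4, BiLoc (fun x z a b => ∑ l' : Fin 4, wsum (fun u => wH (N := n) (d := 3) κ' μ (u - (n : ℤ) • y))
      (fun u => wsum (fun u' => wH (N := n) (d := 3) l' ν (u' - (n : ℤ) • y')) (Wf κ' u l')) x z a b)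
      ((n : ℤ) • y) ((n : ℤ) • y') ((4 : ℕ) * (Cw * (Cw * Cf * Zl 4 (δ / 2)) * Zl 4 (δ / 2 / 2))) (δ / 2 / 2) := by
    intro κ'
    have h := biLoc_finset_sum (Finset.univ : Finset (Fin 4)) (fun l' _ => hterm κ' l')
    simp only [Finset.sum_const, Finset.card_univ, Fintype.card_fin, nsmul_eq_mul] at h
    exact h
  have h := biLoc_finset_sum (Finset.univ : Finset (Fin 4)) (fun κ' _ => hsum κ')
  simp only [Finset.sum_const, Finset.card_univ, Fintype.card_fin, nsmul_eq_mul] at h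
  exact h

/-- [folklore] The packaged form (∃ constant and rate `≤ δ`, via `KernelSpecInstance.decay_wH`; the fibre must be inhabited to read
`0 ≤ Cf` off the hypothesis) — the `hW : VertexFamily₂ W n Cw δ2` input of `ReducedKernelF.absMoment₂_TOfLeg` / `absMoment₂_TOfGh`. -/
theorem vertexFamily₂_tableRedF' [Inhabited F] {Cf δ : ℝ} (hWf : ∀ κ' u l' u', BiLoc (Wf κ' u l' u') u u' Cf δ) (hδ : 0 < δ) :
    ∃ Cw2 δ2 : ℝ, 0 < δ2 ∧ δ2 ≤ δ ∧ VertexFamily₂ (tableRedF n Wf) n Cw2 δ2 := by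
  obtain ⟨δw, Cw, hδw, hwH⟩ := decay_wH (N := n) (d := 3)
  have hCw : 0 ≤ Cw := by
    have h0 := hwH 0 0 0
    simp only [l1, Pi.zero_apply, Int.cast_zero, abs_zero, Finset.sum_const_zero, mul_zero, Real.exp_zero, mul_one] at h0
    exact (abs_nonneg _).trans h0
  have hCf : 0 ≤ Cf := (hWf 0 0 0 0).nonneg default
  have hWf' : ∀ κ' u l' u', BiLoc (Wf κ' u l' u') u u' Cf (min δ δw) :=
    fun κ' u l' u' => biLoc_mono (hWf κ' u l' u') hCf (min_le_left _ _)
  refine ⟨_, _, half_pos (half_pos (lt_min hδ hδw)), ?_, vertexFamily₂_tableRedF n hWf' (lt_min hδ hδw) hCw (min_le_right _ _) hwH⟩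
  have h1 := min_le_left δ δw
  have h2 := lt_min hδ hδw
  linarith

/-- [folklore] **BLOCK COVARIANCE OF THE DRESSED TABLE** from block covariance of the fine tables: if
`Wf κ′ (u + n•t) λ′ (u′ + n•t) = shiftK (−n•t) (Wf κ′ u λ′ u′)` for every block vector `t`, then
`tableRedF n Wf μ (y + t) ν (y′ + t) = shiftK (−n•t) (tableRedF n Wf μ y ν y′)` — the `hW` of `ReducedKernelF.blockCovariant_TOfLeg`. -/
theorem tableRedF_translate (hWf : ∀ (κ' : Fin 4) (u : Site 4) (l' : Fin 4) (u' t : Site 4),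
      Wf κ' (u + (n : ℤ) • t) l' (u' + (n : ℤ) • t) = shiftK (-((n : ℤ) • t)) (Wf κ' u l' u'))
    (μ : Fin 4) (y : Site 4) (ν : Fin 4) (y' t : Site 4) :
    tableRedF n Wf μ (y + t) ν (y' + t) = shiftK (-((n : ℤ) • t)) (tableRedF n Wf μ y ν y') := by
  funext x z a b
  simp only [tableRedF, shiftK]
  refine Finset.sum_congr rfl fun κ' _ => Finset.sum_congr rfl fun l' _ => ?_
  have hw : (fun u : Site 4 => wH (N := n) (d := 3) κ' μ (u - (n : ℤ) • (y + t))) =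
      fun u => (fun u₀ : Site 4 => wH (N := n) (d := 3) κ' μ (u₀ - (n : ℤ) • y)) (u - (n : ℤ) • t) := by
    funext u; simp only [smul_add]; congr 1; abel
  have hw' : (fun u' : Site 4 => wH (N := n) (d := 3) l' ν (u' - (n : ℤ) • (y' + t))) =
      fun u' => (fun u₀ : Site 4 => wH (N := n) (d := 3) l' ν (u₀ - (n : ℤ) • y')) (u' - (n : ℤ) • t) := by
    funext u'; simp only [smul_add]; congr 1; abel
  have hK : ∀ u : Site 4, Wf κ' u l' = fun u' => shiftK (-((n : ℤ) • t)) ((Wf κ' (u - (n : ℤ) • t) l') (u' - (n : ℤ) • t)) := by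
    intro u; funext u'
    simpa only [sub_add_cancel] using hWf κ' (u - (n : ℤ) • t) l' (u' - (n : ℤ) • t) t
  have hin : (fun u : Site 4 => wsum (fun u' => wH (N := n) (d := 3) l' ν (u' - (n : ℤ) • (y' + t))) (Wf κ' u l')) =
      fun u => shiftK (-((n : ℤ) • t)) ((fun u₀ : Site 4 => wsum (fun u' => wH (N := n) (d := 3) l' ν (u' - (n : ℤ) • y'))
        (Wf κ' u₀ l')) (u - (n : ℤ) • t)) := by
    funext u
    rw [hw', hK u, wsum_shiftK (fun u' => (fun u₀ : Site 4 => wH (N := n) (d := 3) l' ν (u₀ - (n : ℤ) • y')) (u' - (n : ℤ) • t))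
      (fun u' => (Wf κ' (u - (n : ℤ) • t) l') (u' - (n : ℤ) • t)) (-((n : ℤ) • t)),
      wsum_sub (fun u₀ : Site 4 => wH (N := n) (d := 3) l' ν (u₀ - (n : ℤ) • y')) (Wf κ' (u - (n : ℤ) • t) l') ((n : ℤ) • t)]
  rw [hw, hin, wsum_shiftK (fun u => (fun u₀ : Site 4 => wH (N := n) (d := 3) κ' μ (u₀ - (n : ℤ) • y)) (u - (n : ℤ) • t))
    (fun u => (fun u₀ : Site 4 => wsum (fun u' => wH (N := n) (d := 3) l' ν (u' - (n : ℤ) • y')) (Wf κ' u₀ l')) (u - (n : ℤ) • t))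
    (-((n : ℤ) • t)),
    wsum_sub (fun u₀ : Site 4 => wH (N := n) (d := 3) κ' μ (u₀ - (n : ℤ) • y))
    (fun u₀ : Site 4 => wsum (fun u' => wH (N := n) (d := 3) l' ν (u' - (n : ℤ) • y')) (Wf κ' u₀ l')) ((n : ℤ) • t)]
  rfl

end Summit.QuantumFields.BalabanUV.Beta.D1BFx.ReducedTableF

end
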